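import Literature.Computability.QuantumComplexity.HaarUnitaryHiding
import Literature.MathematicalPhysics.KineticTheory.HardSphereEulerProofs
import HarnessLib

/-!
# The Haar-Unitary Hiding Theorem from the density of truncated Haar unitaries (Aaronson–Arkhipov 2013, §5.1): proofs

Family `quantum-advantage`; companion to `HaarUnitaryHiding.lean` (same namespace), which vendors
S. Aaronson, A. Arkhipov, *The computational complexity of linear optics*, Theory of Computing 9
(2013) 143–252 (AA13), Thm. 5.2 (Haar-Unitary Hiding Theorem, p. 183) as the named fact
`haarUnitaryHiding` and derives Thm. 5.1 from it. This file **proves Thm. 5.2** — hence Thm. 5.1 —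
from the one random-matrix input of AA13's proof, the explicit density of the scaled truncation
`𝒮_{m,n}`, which AA13 quote (eq. (5.5), p. 184: "Réffy [55, p. 61] has shown that, provided
`m ≥ 2n`, we have `p_S(X) = c_{m,n} ∏_{i ∈ [n]} (1 − λᵢ/m)^{m−2n} I_{λᵢ ≤ m}` for some constant
`c_{m,n}`", `λᵢ` the squared singular values of `X`; J. Réffy, *Asymptotics of random unitaries*,
PhD thesis, BUTE 2005, p. 61; D. Petz, J. Réffy, *Large deviation for the empirical eigenvalue
density of truncated Haar unitary matrices*, Probab. Theory Relat. Fields 133 (2005) 175–189,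
Appendix: "for `m ≥ 2n`, the distribution measure of the `n × n` matrix `A` is absolute continuous
with respect to `λₙ` and the density is `C(n,m) det(1 − A*A)^{m−2n} 1_{‖A‖ ≤ 1} dλₙ(A)`", after
B. Collins' thesis, Paris 6, 2003). That formula is vendored here as the named fact
`truncatedHaarDensity` (a `Prop`; its proof is a Jacobian computation on `U(m)` not available in
Mathlib), and the main results are

* `haarUnitaryHiding_of_truncatedHaarDensity : truncatedHaarDensity → haarUnitaryHiding`
  (AA13 Thm. 5.2), and
* `haarUnitaryTruncation_tv_of_truncatedHaarDensity : truncatedHaarDensity → haarUnitaryTruncation_tv`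
  (AA13 Thm. 5.1).

## The proof (AA13 pp. 184–190, the one-sided half)

Write `p_G(X) = π^{-n²} e^{−∑ᵢⱼ|xᵢⱼ|²} = π^{-n²} ∏ᵢ e^{−λᵢ}` (eq. (5.4), using (5.3)
`∑ᵢⱼ |xᵢⱼ|² = ∑ᵢ λᵢ`; `gaussDensity`, `gaussianMatrixMeasure_eq_withDensity`) and
`p_S = c · shape`, `shape(X) = ∏ᵢ (1 − λᵢ/m)^{m−2n} 𝟙[λᵢ ≤ m]` (eq. (5.5); `truncatedHaarShape`).
With `f(λ) = λ + (m − 2n) ln(1 − λ/m)` (eq. (5.65)):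

1. `f(λ) ≤ f(2n) ≤ 4n²/m` on `[0, m)` (concavity, eqs. (5.66)–(5.69)), so
   `shape ≤ π^{n²} e^{4n³/m} p_G` everywhere (`truncatedHaarShape_le`);
2. `f(λ) ≥ −λ²/(m − λ) ≥ −2k²/m` for `λ ≤ k ≤ m/2` (eqs. (5.35)–(5.40)), so on the head
   `{∑|xᵢⱼ|² ≤ k}` (where every `λᵢ ≤ k`) `shape ≥ (1 − 2nk²/m) π^{n²} p_G` (eqs. (5.41)–(5.42);
   `le_truncatedHaarShape`);
3. the Gaussian tail `𝒢{∑|xᵢⱼ|² > k} ≤ n² · Pr[|x₁₁|² > k/n²] ≤ 2n² e^{−k/(2n²)}` (Lemma 5.3,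
   union bound; the Chernoff bound `Pr[|z|² ≥ a] ≤ 2e^{−a/2}` replaces the exact `e^{−a}`);
4. integrating 2. over the head and using `∫ p_S = 1`:
   `c π^{n²} (1 − 2nk²/m)(1 − 2n² e^{−k/(2n²)}) ≤ 1` — the lower bound on AA13's `ζ = 1/(c π^{n²})`
   that Lemma 5.6 extracts (the upper bound, which needs Lemma 5.4 and eq. (5.14), is only used for
   the two-sided Thm. 5.1 and is not needed here, Thm. 5.1 being derived from Thm. 5.2 in
   `HaarUnitaryHiding.lean`);
5. integrating 1. over `E`: `𝒮(E) ≤ c π^{n²} e^{4n³/m} 𝒢(E)`; with `k = 6n² ln(n/δ)` and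
   `m ≥ n⁵ ln²(n/δ)/δ` the constants give `𝒮(E) ≤ (1 + 150δ) 𝒢(E)` for `δ ≤ 1/200`
   (`haarUnitaryHiding_of_truncatedHaarDensity`; the named fact asks for some `C, δ₀`).

Measurability of the eigenvalue functions `X ↦ λᵢ(X)` is never needed: the head is the Frobenius
ball, and all comparisons with `shape` are pointwise.

## References

* S. Aaronson, A. Arkhipov, *The computational complexity of linear optics*, Theory of Computing 9
  (2013) 143–252, §5.1, eqs. (5.3)–(5.5), Lemma 5.3, Lemma 5.5, Lemma 5.6, Thm. 5.1, Thm. 5.2.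
* D. Petz, J. Réffy, *Large deviation for the empirical eigenvalue density of truncated Haar unitary
  matrices*, Probab. Theory Relat. Fields 133 (2005) 175–189 (arXiv:math/0409552), Appendix.
* J. Réffy, *Asymptotics of random unitaries*, PhD thesis, Budapest University of Technology and
  Economics, 2005, p. 61 (AA13's reference [55]; not held).
-/

open MeasureTheory Matrix Real Finset ProbabilityTheory

open scoped ComplexOrder ENNReal NNReal

namespace Literature.Computability.QuantumComplexity

/-! ### Squared singular values -/

/-- The squared singular values `λ₁(X), …, λₙ(X)` of an `n × n` complex array `X`: the eigenvalues
of the positive semidefinite matrix `Xᴴ X` (AA13 §5.1, p. 184: "let `λᵢ := dᵢᵢ²` be the square of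
the `i`-th singular value of `X`"), in Mathlib's enumeration `Matrix.IsHermitian.eigenvalues`.
[cite: AaronsonArkhipovToC2013, §5.1 (p. 184)] -/
noncomputable def sqSingularValue {n : ℕ} (X : Fin n → Fin n → ℂ) (i : Fin n) : ℝ :=
  (isHermitian_conjTranspose_mul_self (Matrix.of X)).eigenvalues i

/-- Squared singular values are nonnegative (`Xᴴ X` is positive semidefinite). [folklore] -/
theorem sqSingularValue_nonneg {n : ℕ} (X : Fin n → Fin n → ℂ) (i : Fin n) :
    0 ≤ sqSingularValue X i :=
  (posSemidef_conjTranspose_mul_self (Matrix.of X)).eigenvalues_nonneg i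

/-- The squared Frobenius norm `∑ᵢⱼ |xᵢⱼ|²` of an array. [folklore] -/
noncomputable def frobSq {n : ℕ} (X : Fin n → Fin n → ℂ) : ℝ :=
  ∑ i, ∑ j, ‖X i j‖ ^ 2

/-- `∑ᵢⱼ |xᵢⱼ|² = ∑ᵢ λᵢ` (AA13 eq. (5.3): the trace of `Xᴴ X` computed entrywise and
spectrally). [cite: AaronsonArkhipovToC2013, eq. (5.3) (p. 184)] -/
theorem frobSq_eq_sum_sqSingularValue {n : ℕ} (X : Fin n → Fin n → ℂ) :
    frobSq X = ∑ i, sqSingularValue X i := by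
  have hA := isHermitian_conjTranspose_mul_self (Matrix.of X)
  have htr : ((Matrix.of X)ᴴ * Matrix.of X).trace = ((frobSq X : ℝ) : ℂ) := by
    simp only [Matrix.trace, Matrix.diag, Matrix.mul_apply, Matrix.conjTranspose_apply,
      Matrix.of_apply, frobSq]
    rw [Finset.sum_comm]
    push_cast
    refine Finset.sum_congr rfl fun i _ => Finset.sum_congr rfl fun j _ => ?_
    rw [← Complex.conj_mul']
    rfl
  have h2 := hA.trace_eq_sum_eigenvalues
  rw [htr] at h2
  have h3 : ((frobSq X : ℝ) : ℂ) = ((∑ i, sqSingularValue X i : ℝ) : ℂ) := by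
    rw [h2]; push_cast; rfl
  exact_mod_cast h3

/-- Each squared singular value is at most the squared Frobenius norm. [folklore] -/
theorem sqSingularValue_le_frobSq {n : ℕ} (X : Fin n → Fin n → ℂ) (i : Fin n) :
    sqSingularValue X i ≤ frobSq X := by
  rw [frobSq_eq_sum_sqSingularValue]
  exact Finset.single_le_sum (fun j _ => sqSingularValue_nonneg X j) (Finset.mem_univ i)

/-! ### The two densities -/

/-- The Gaussian density `p_G(X) = π^{-n²} exp(−∑ᵢⱼ |xᵢⱼ|²)` of `𝒢^{n×n}` with respect to Lebesgue
measure on `ℂ^{n×n}` (AA13 eq. (5.4)). [cite: AaronsonArkhipovToC2013, eq. (5.4) (p. 184)] -/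
noncomputable def gaussDensity (n : ℕ) (X : Fin n → Fin n → ℂ) : ℝ :=
  (π ^ (n * n))⁻¹ * Real.exp (-frobSq X)

/-- Réffy's density of `𝒮_{m,n}` up to its normalising constant (AA13 eq. (5.5)):
`∏ᵢ (1 − λᵢ/m)^{m−2n}` if all `λᵢ ≤ m`, and `0` otherwise. [cite: AaronsonArkhipovToC2013, eq. (5.5) (p. 184)] -/
noncomputable def truncatedHaarShape (m n : ℕ) (X : Fin n → Fin n → ℂ) : ℝ :=
  if ∀ i, sqSingularValue X i ≤ m then ∏ i, (1 - sqSingularValue X i / m) ^ (m - 2 * n) else 0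

/-- `p_G > 0`. [folklore] -/
theorem gaussDensity_pos (n : ℕ) (X : Fin n → Fin n → ℂ) : 0 < gaussDensity n X := by
  unfold gaussDensity; positivity

/-- `shape ≥ 0` (on the indicator set every factor `1 − λᵢ/m` is in `[0, 1]`). [folklore] -/
theorem truncatedHaarShape_nonneg (m n : ℕ) (X : Fin n → Fin n → ℂ) :
    0 ≤ truncatedHaarShape m n X := by
  unfold truncatedHaarShape
  split_ifs with h
  · refine Finset.prod_nonneg fun i _ => pow_nonneg ?_ _
    rcases Nat.eq_zero_or_pos m with rfl | hm
    · simp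
    · have : sqSingularValue X i / m ≤ 1 := by
        rw [div_le_one (by exact_mod_cast hm)]; exact h i
      linarith
  · exact le_rfl

/-- `shape` in AA13's verbatim form `∏ᵢ (1 − λᵢ/m)^{m−2n} I_{λᵢ ≤ m}` (eq. (5.5)): a product of
per-index indicators vanishes as soon as one `λᵢ > m`. [cite: AaronsonArkhipovToC2013, eq. (5.5) (p. 184)] -/
theorem truncatedHaarShape_eq_prod_indicator (m n : ℕ) (X : Fin n → Fin n → ℂ) :
    truncatedHaarShape m n X =
      ∏ i, (1 - sqSingularValue X i / m) ^ (m - 2 * n) *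
        (if sqSingularValue X i ≤ m then 1 else 0) := by
  unfold truncatedHaarShape
  split_ifs with h
  · exact Finset.prod_congr rfl fun i _ => by rw [if_pos (h i), mul_one]
  · push Not at h
    obtain ⟨i, hi⟩ := h
    symm
    exact Finset.prod_eq_zero (Finset.mem_univ i) (by rw [if_neg (not_le.2 hi), mul_zero])

/-! ### The density formula for truncated Haar unitaries (named fact) -/

/-- **The density of truncated Haar unitaries** (AA13 eq. (5.5), p. 184, quoting Réffy 2005,
p. 61; Petz–Réffy 2005, Appendix, after Collins 2003): "provided `m ≥ 2n`, we have
`p_S(X) = c_{m,n} ∏_{i ∈ [n]} (1 − λᵢ/m)^{m−2n} I_{λᵢ ≤ m}` for some constant `c_{m,n}`, where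
`I_{λᵢ ≤ m}` equals `1` if `λᵢ ≤ m` and `0` otherwise" — `p_S` the density of `𝒮_{m,n}` (the law
`truncatedHaarMeasure m n h` of `√m` times the top-left `n × n` block of a Haar-random `U ∈ U(m)`)
with respect to Lebesgue measure on `ℂ^{n×n}` (`volume` on `Fin n → Fin n → ℂ`, the product of the
Lebesgue measures of the entries, AA13 eq. (5.2)), and `λᵢ = λᵢ(X)` the squared singular values of
`X` (`sqSingularValue`). In measure form: for all `m ≥ 2n` there is a real constant `c` with
`𝒮_{m,n} = (c · shape) · Lebesgue`, `shape = truncatedHaarShape m n`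
(`truncatedHaarShape_eq_prod_indicator`). Equivalently (Petz–Réffy 2005, Appendix, for the
unscaled block `A = X/√m`): "for `m ≥ 2n`, the distribution measure of the `n × n` matrix `A` is
absolute continuous with respect to `λₙ` and the density is
`C(n,m) det(1 − A*A)^{m−2n} 1_{‖A‖ ≤ 1} dλₙ(A)`" (`det(1 − A*A) = ∏ᵢ (1 − λᵢ/m)`, and `‖A‖ ≤ 1` iff
all `λᵢ ≤ m`). The positivity `c > 0` is a consequence (`density_const_nonneg` gives `c ≥ 0`) and is
not asserted. Not in Mathlib (a Jacobian computation for the block decomposition of Haar measure on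
`U(m)`); stated as a `Prop`.
[cite: AaronsonArkhipovToC2013, eq. (5.5) (p. 184)] [cite: PetzReffy2005, Appendix] -/
def truncatedHaarDensity : Prop :=
  ∀ (m n : ℕ) (h : n ≤ m), 2 * n ≤ m →
    ∃ c : ℝ, truncatedHaarMeasure m n h =
      volume.withDensity (fun X => ENNReal.ofReal (c * truncatedHaarShape m n X))

/-! ### The two scalar inequalities of AA13 §5.1 -/

/-- Upper bound (AA13 eqs. (5.64)–(5.69)): for `0 ≤ λ ≤ m` and `2n < m`,
`(1 − λ/m)^{m−2n} e^{λ} ≤ e^{4n²/m}` — the function `f(λ) = λ + (m − 2n) ln(1 − λ/m)` is concave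
with maximum at `λ = 2n`, where `f(2n) ≤ 4n²/m`. [cite: AaronsonArkhipovToC2013, eqs. (5.64)–(5.69) (pp. 189–190)] -/
theorem pow_mul_exp_le {m n : ℕ} (hnm : 2 * n < m) {t : ℝ} (ht0 : 0 ≤ t) (htm : t ≤ m) :
    (1 - t / m) ^ (m - 2 * n) * Real.exp t ≤ Real.exp (4 * (n : ℝ) ^ 2 / m) := by
  have hm0 : (0 : ℝ) < m := by exact_mod_cast (show 0 < m by omega)
  rcases eq_or_lt_of_le htm with rfl | htm'
  · -- t = m: the power vanishes
    have hk : m - 2 * n ≠ 0 := by omega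
    rw [div_self hm0.ne', sub_self, zero_pow hk, zero_mul]
    exact (Real.exp_pos _).le
  set y : ℝ := 1 - t / m with hy
  set y₀ : ℝ := 1 - 2 * (n : ℝ) / m with hy₀
  have hy_pos : 0 < y := by
    rw [hy, sub_pos, div_lt_one hm0]; exact htm'
  have hy₀_pos : 0 < y₀ := by
    rw [hy₀, sub_pos, div_lt_one hm0]; exact_mod_cast hnm
  have hk : ((m - 2 * n : ℕ) : ℝ) = (m : ℝ) - 2 * n := by
    rw [Nat.cast_sub hnm.le]; push_cast; ring
  -- log y ≤ log y₀ + y / y₀ - 1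
  have hlog : Real.log y ≤ Real.log y₀ + (y / y₀ - 1) := by
    have := Real.log_le_sub_one_of_pos (div_pos hy_pos hy₀_pos)
    rw [Real.log_div hy_pos.ne' hy₀_pos.ne'] at this
    linarith
  have hlog₀ : Real.log y₀ ≤ y₀ - 1 := Real.log_le_sub_one_of_pos hy₀_pos
  -- the exponent
  have hexp : ((m : ℝ) - 2 * n) * Real.log y + t ≤ 4 * (n : ℝ) ^ 2 / m := by
    have hc : (0 : ℝ) ≤ (m : ℝ) - 2 * n := by
      have : (2 * n : ℝ) < m := by exact_mod_cast hnm
      linarith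
    have h1 : ((m : ℝ) - 2 * n) * Real.log y ≤
        ((m : ℝ) - 2 * n) * Real.log y₀ + ((m : ℝ) - 2 * n) * (y / y₀ - 1) :=
      by nlinarith [mul_le_mul_of_nonneg_left hlog hc]
    have h2 : ((m : ℝ) - 2 * n) * (y / y₀ - 1) = 2 * n - t := by
      have hy₀' : ((m : ℝ) - 2 * n) = m * y₀ := by
        rw [hy₀]; field_simp
      have : ((m : ℝ) - 2 * n) / y₀ = m := by
        rw [div_eq_iff hy₀_pos.ne', hy₀']
      calc ((m : ℝ) - 2 * n) * (y / y₀ - 1)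
          = ((m : ℝ) - 2 * n) / y₀ * y - ((m : ℝ) - 2 * n) := by ring
        _ = m * y - ((m : ℝ) - 2 * n) := by rw [this]
        _ = 2 * n - t := by rw [hy]; field_simp; ring
    have h3 : ((m : ℝ) - 2 * n) * Real.log y₀ ≤ ((m : ℝ) - 2 * n) * (y₀ - 1) :=
      mul_le_mul_of_nonneg_left hlog₀ hc
    have h4 : ((m : ℝ) - 2 * n) * (y₀ - 1) + 2 * n = 4 * (n : ℝ) ^ 2 / m := by
      rw [hy₀]; field_simp; ring
    linarith
  calc (1 - t / m) ^ (m - 2 * n) * Real.exp t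
      = Real.exp (((m - 2 * n : ℕ) : ℝ) * Real.log y + t) := by
        rw [Real.exp_add, ← Real.log_pow, Real.exp_log (pow_pos hy_pos _)]
    _ ≤ Real.exp (4 * (n : ℝ) ^ 2 / m) := by
        rw [Real.exp_le_exp, hk]; exact hexp

/-- Lower bound (AA13 eqs. (5.35)–(5.40)): for `0 ≤ λ ≤ k`, `2k ≤ m` and `2n ≤ m`,
`e^{−2k²/m} ≤ (1 − λ/m)^{m−2n} e^{λ}`, since `f(λ) ≥ −λ²/(m − λ) ≥ −2k²/m`.
[cite: AaronsonArkhipovToC2013, eqs. (5.35)–(5.40) (p. 187)] -/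
theorem exp_neg_le_pow_mul_exp {m n : ℕ} (hnm : 2 * n ≤ m) {k t : ℝ} (ht0 : 0 ≤ t) (htk : t ≤ k)
    (hkm : 2 * k ≤ m) (hm : 0 < m) :
    Real.exp (-(2 * k ^ 2 / m)) ≤ (1 - t / m) ^ (m - 2 * n) * Real.exp t := by
  have hm0 : (0 : ℝ) < m := by exact_mod_cast hm
  have htm : t < m := by
    have hk0 : 0 ≤ k := ht0.trans htk
    nlinarith
  set y : ℝ := 1 - t / m with hy
  have hy_pos : 0 < y := by rw [hy, sub_pos, div_lt_one hm0]; exact htm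
  have hk' : ((m - 2 * n : ℕ) : ℝ) = (m : ℝ) - 2 * n := by
    rw [Nat.cast_sub hnm]; push_cast; ring
  have hc : (0 : ℝ) ≤ (m : ℝ) - 2 * n := by
    have : (2 * n : ℝ) ≤ m := by exact_mod_cast hnm
    linarith
  -- log y ≥ 1 - 1/y = -t/(m - t)
  have hmt : 0 < (m : ℝ) - t := by linarith
  have hlog : -(t / (m - t)) ≤ Real.log y := by
    have h := Real.one_sub_inv_le_log_of_pos hy_pos
    have : 1 - y⁻¹ = -(t / (m - t)) := by
      have hmt' : (m : ℝ) - t ≠ 0 := hmt.ne'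
      rw [hy, inv_eq_one_div, eq_neg_iff_add_eq_zero]
      field_simp
      ring
    linarith
  have hexp : -(2 * k ^ 2 / m) ≤ ((m : ℝ) - 2 * n) * Real.log y + t := by
    have h1 : ((m : ℝ) - 2 * n) * -(t / (m - t)) ≤ ((m : ℝ) - 2 * n) * Real.log y :=
      mul_le_mul_of_nonneg_left hlog hc
    -- (m - 2n) * t/(m-t) ≤ m * t/(m - t), so f ≥ t - m t/(m-t) = -t²/(m-t)
    have h2 : -(t ^ 2 / (m - t)) ≤ ((m : ℝ) - 2 * n) * -(t / (m - t)) + t := by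
      have hn0 : (0 : ℝ) ≤ n := Nat.cast_nonneg n
      have : ((m : ℝ) - 2 * n) * (t / (m - t)) ≤ m * (t / (m - t)) :=
        mul_le_mul_of_nonneg_right (by linarith) (div_nonneg ht0 hmt.le)
      have e : -(t ^ 2 / (m - t)) = -(m * (t / (m - t))) + t := by field_simp; ring
      linarith
    -- t²/(m-t) ≤ 2k²/m since t ≤ k and m - t ≥ m/2
    have h3 : t ^ 2 / (m - t) ≤ 2 * k ^ 2 / m := by
      rw [div_le_div_iff₀ hmt hm0]
      have hk0 : 0 ≤ k := ht0.trans htk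
      have : t ^ 2 ≤ k ^ 2 := pow_le_pow_left₀ ht0 htk 2
      nlinarith
    linarith
  calc Real.exp (-(2 * k ^ 2 / m))
      ≤ Real.exp (((m - 2 * n : ℕ) : ℝ) * Real.log y + t) := by
        rw [Real.exp_le_exp, hk']; exact hexp
    _ = (1 - t / m) ^ (m - 2 * n) * Real.exp t := by
        rw [Real.exp_add, ← Real.log_pow, Real.exp_log (pow_pos hy_pos _)]

/-! ### Pointwise comparison of the two densities -/

/-- `exp(−∑ᵢⱼ |xᵢⱼ|²) = ∏ᵢ exp(−λᵢ)`. [cite: AaronsonArkhipovToC2013, eq. (5.4) (p. 184)] -/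
theorem exp_neg_frobSq {n : ℕ} (X : Fin n → Fin n → ℂ) :
    Real.exp (-frobSq X) = ∏ i, Real.exp (-sqSingularValue X i) := by
  rw [frobSq_eq_sum_sqSingularValue, ← Finset.sum_neg_distrib, Real.exp_sum]

/-- **Pointwise upper bound** (AA13, proof of Thm. 5.2, eqs. (5.63)–(5.69)): for `m > 2n`,
`p̃_S(X) ≤ e^{4n³/m} p_G(X)` for every `X`, i.e.
`shape(X) ≤ π^{n²} e^{4n³/m} p_G(X)`. [cite: AaronsonArkhipovToC2013, eqs. (5.63)–(5.69) (pp. 189–190)] -/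
theorem truncatedHaarShape_le {m n : ℕ} (hnm : 2 * n < m) (X : Fin n → Fin n → ℂ) :
    truncatedHaarShape m n X ≤
      π ^ (n * n) * Real.exp (4 * (n : ℝ) ^ 3 / m) * gaussDensity n X := by
  have hπ : (0 : ℝ) < π ^ (n * n) := by positivity
  have hrhs : π ^ (n * n) * Real.exp (4 * (n : ℝ) ^ 3 / m) * gaussDensity n X =
      (∏ _i : Fin n, Real.exp (4 * (n : ℝ) ^ 2 / m)) * ∏ i, Real.exp (-sqSingularValue X i) := by
    rw [gaussDensity, exp_neg_frobSq, Finset.prod_const, Finset.card_univ, Fintype.card_fin,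
      ← Real.exp_nat_mul]
    have : (n : ℝ) * (4 * (n : ℝ) ^ 2 / m) = 4 * (n : ℝ) ^ 3 / m := by ring
    rw [this]; field_simp
  rw [hrhs]
  unfold truncatedHaarShape
  split_ifs with h
  · have hm0 : (0 : ℝ) < m := by exact_mod_cast (show 0 < m by omega)
    calc ∏ i, (1 - sqSingularValue X i / m) ^ (m - 2 * n)
        = ∏ i, ((1 - sqSingularValue X i / m) ^ (m - 2 * n) * Real.exp (sqSingularValue X i) *
            Real.exp (-sqSingularValue X i)) := by
          refine Finset.prod_congr rfl fun i _ => ?_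
          rw [mul_assoc, ← Real.exp_add, add_neg_cancel, Real.exp_zero, mul_one]
      _ = (∏ i, (1 - sqSingularValue X i / m) ^ (m - 2 * n) * Real.exp (sqSingularValue X i)) *
            ∏ i, Real.exp (-sqSingularValue X i) := Finset.prod_mul_distrib
      _ ≤ (∏ _i : Fin n, Real.exp (4 * (n : ℝ) ^ 2 / m)) * ∏ i, Real.exp (-sqSingularValue X i) := by
          refine mul_le_mul_of_nonneg_right ?_ (Finset.prod_nonneg fun i _ => (Real.exp_pos _).le)
          refine Finset.prod_le_prod (fun i _ => mul_nonneg (pow_nonneg ?_ _) (Real.exp_pos _).le)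
            (fun i _ => pow_mul_exp_le hnm (sqSingularValue_nonneg X i) (h i))
          have : sqSingularValue X i / m ≤ 1 := by rw [div_le_one hm0]; exact h i
          linarith
  · exact mul_nonneg (Finset.prod_nonneg fun _ _ => (Real.exp_pos _).le)
      (Finset.prod_nonneg fun _ _ => (Real.exp_pos _).le)

/-- **Pointwise lower bound on the head** (AA13 Lemma 5.5, eqs. (5.35)–(5.42)): if
`∑ᵢⱼ |xᵢⱼ|² ≤ k`, `2k ≤ m` and `2n ≤ m`, then `p̃_S(X) ≥ (1 − 2nk²/m) p_G(X)`, i.e.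
`(1 − 2nk²/m) π^{n²} p_G(X) ≤ shape(X)`. [cite: AaronsonArkhipovToC2013, Lemma 5.5, eqs. (5.35)–(5.42) (pp. 186–188)] -/
theorem le_truncatedHaarShape {m n : ℕ} (hnm : 2 * n ≤ m) (hm : 0 < m) {k : ℝ} (hkm : 2 * k ≤ m)
    (X : Fin n → Fin n → ℂ) (hX : frobSq X ≤ k) :
    (1 - 2 * n * k ^ 2 / m) * π ^ (n * n) * gaussDensity n X ≤ truncatedHaarShape m n X := by
  have hm0 : (0 : ℝ) < m := by exact_mod_cast hm
  have hev : ∀ i, sqSingularValue X i ≤ k := fun i => (sqSingularValue_le_frobSq X i).trans hX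
  have hk0 : 0 ≤ k := by
    rcases Nat.eq_zero_or_pos n with rfl | hn
    · -- no entries: frobSq = 0
      have : frobSq X = 0 := by simp [frobSq]
      linarith
    · exact (sqSingularValue_nonneg X ⟨0, hn⟩).trans (hev ⟨0, hn⟩)
  have hevm : ∀ i, sqSingularValue X i ≤ m := fun i => (hev i).trans (by linarith)
  have hlhs : (1 - 2 * n * k ^ 2 / m) * π ^ (n * n) * gaussDensity n X =
      (1 - 2 * n * k ^ 2 / m) * ∏ i, Real.exp (-sqSingularValue X i) := by
    rw [gaussDensity, exp_neg_frobSq]; field_simp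
  rw [hlhs, truncatedHaarShape, if_pos hevm]
  have hprod : Real.exp (-(2 * n * k ^ 2 / m)) ≤
      ∏ i, (1 - sqSingularValue X i / m) ^ (m - 2 * n) * Real.exp (sqSingularValue X i) := by
    calc Real.exp (-(2 * n * k ^ 2 / m)) = ∏ _i : Fin n, Real.exp (-(2 * k ^ 2 / m)) := by
          rw [Finset.prod_const, Finset.card_univ, Fintype.card_fin, ← Real.exp_nat_mul]
          congr 1; ring
      _ ≤ ∏ i, (1 - sqSingularValue X i / m) ^ (m - 2 * n) * Real.exp (sqSingularValue X i) :=
          Finset.prod_le_prod (fun i _ => (Real.exp_pos _).le) fun i _ =>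
            exp_neg_le_pow_mul_exp hnm (sqSingularValue_nonneg X i) (hev i) hkm hm
  have h1 : 1 - 2 * n * k ^ 2 / m ≤ Real.exp (-(2 * n * k ^ 2 / m)) := by
    have := Real.add_one_le_exp (-(2 * n * k ^ 2 / m)); linarith
  calc (1 - 2 * n * k ^ 2 / m) * ∏ i, Real.exp (-sqSingularValue X i)
      ≤ (∏ i, (1 - sqSingularValue X i / m) ^ (m - 2 * n) * Real.exp (sqSingularValue X i)) *
          ∏ i, Real.exp (-sqSingularValue X i) :=
        mul_le_mul_of_nonneg_right (h1.trans hprod)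
          (Finset.prod_nonneg fun _ _ => (Real.exp_pos _).le)
    _ = ∏ i, (1 - sqSingularValue X i / m) ^ (m - 2 * n) := by
        rw [← Finset.prod_mul_distrib]
        refine Finset.prod_congr rfl fun i _ => ?_
        rw [mul_assoc, ← Real.exp_add, add_neg_cancel, Real.exp_zero, mul_one]

/-! ### The Gaussian ensemble has density `p_G` -/

/-- The density `π⁻¹ e^{−|z|²}` of the standard complex Gaussian. [folklore] -/
noncomputable def stdComplexGaussianDensity (z : ℂ) : ℝ :=
  π⁻¹ * Real.exp (-‖z‖ ^ 2)

/-- The complex Gaussian density is continuous. [folklore] -/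
theorem continuous_stdComplexGaussianDensity : Continuous stdComplexGaussianDensity := by
  unfold stdComplexGaussianDensity; fun_prop

/-- The complex Gaussian density is positive. [folklore] -/
theorem stdComplexGaussianDensity_pos (z : ℂ) : 0 < stdComplexGaussianDensity z := by
  unfold stdComplexGaussianDensity; positivity

/-- `withDensity` transported along a measurable equivalence. [folklore] -/
theorem map_withDensity_equiv {α β : Type*} [MeasurableSpace α] [MeasurableSpace β]
    (μ : Measure α) (e : α ≃ᵐ β) (f : α → ℝ≥0∞) :
    (μ.withDensity f).map e = (μ.map e).withDensity (f ∘ e.symm) := by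
  ext s hs
  rw [Measure.map_apply e.measurable hs, withDensity_apply _ (e.measurable hs),
    withDensity_apply _ hs, Measure.restrict_map e.measurable hs, lintegral_map_equiv]
  simp only [Function.comp_apply, e.symm_apply_apply]

/-- The one-dimensional density: `gaussianPDFReal 0 (1/2) x = π^{-1/2} e^{−x²}`. [folklore] -/
theorem gaussianPDFReal_half (x : ℝ) :
    gaussianPDFReal 0 (1 / 2 : ℝ≥0) x = (Real.sqrt π)⁻¹ * Real.exp (-x ^ 2) := by
  rw [gaussianPDFReal_def]
  dsimp only
  have h2 : ((1 / 2 : ℝ≥0) : ℝ) = 1 / 2 := by norm_num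
  have ha : (2 : ℝ) * π * (1 / 2) = π := by ring
  have hb : -(x - 0) ^ 2 / (2 * (1 / 2)) = -x ^ 2 := by ring
  rw [h2, ha, hb]

/-- **The standard complex Gaussian has density `π⁻¹ e^{−|z|²}`** with respect to Lebesgue measure
on `ℂ` (real and imaginary parts independent `𝒩(0, 1/2)`). [cite: AaronsonArkhipovToC2013, §1.2 (p. 150), eq. (5.4) (p. 184)] -/
theorem stdComplexGaussian_eq_withDensity :
    stdComplexGaussian = volume.withDensity (fun z => ENNReal.ofReal (stdComplexGaussianDensity z)) := by
  have hv : (1 / 2 : ℝ≥0) ≠ 0 := by norm_num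
  rw [stdComplexGaussian, gaussianReal_of_var_ne_zero 0 hv,
    prod_withDensity (measurable_gaussianPDF 0 _) (measurable_gaussianPDF 0 _)]
  rw [map_withDensity_equiv]
  have hvol : Measure.map Complex.measurableEquivRealProd.symm
      ((volume : Measure ℝ).prod (volume : Measure ℝ)) = (volume : Measure ℂ) :=
    Complex.volume_preserving_equiv_real_prod.symm.map_eq
  rw [hvol]
  congr 1
  funext z
  simp only [Function.comp_apply, MeasurableEquiv.symm_symm, Complex.measurableEquivRealProd_apply,
    gaussianPDF, gaussianPDFReal_half, stdComplexGaussianDensity]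
  rw [← ENNReal.ofReal_mul (by positivity)]
  congr 1
  have hπ : Real.sqrt π * Real.sqrt π = π := Real.mul_self_sqrt Real.pi_pos.le
  rw [Complex.sq_norm, Complex.normSq_apply]
  calc (Real.sqrt π)⁻¹ * Real.exp (-z.re ^ 2) * ((Real.sqrt π)⁻¹ * Real.exp (-z.im ^ 2))
      = (Real.sqrt π * Real.sqrt π)⁻¹ * (Real.exp (-z.re ^ 2) * Real.exp (-z.im ^ 2)) := by
        rw [mul_inv]; ring
    _ = π⁻¹ * Real.exp (-(z.re * z.re + z.im * z.im)) := by
        rw [hπ, ← Real.exp_add]; congr 1; ring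

/-- `π⁻¹ e^{−|z|²} · Lebesgue` is σ-finite (it is the probability measure `stdComplexGaussian`).
[folklore] -/
theorem sigmaFinite_withDensity_stdComplexGaussianDensity :
    SigmaFinite (volume.withDensity fun z : ℂ => ENNReal.ofReal (stdComplexGaussianDensity z)) := by
  rw [← stdComplexGaussian_eq_withDensity]; infer_instance

/-- `p_G` is the product of the entry densities. [cite: AaronsonArkhipovToC2013, eq. (5.4) (p. 184)] -/
theorem gaussDensity_eq_prod (n : ℕ) (X : Fin n → Fin n → ℂ) :
    gaussDensity n X = ∏ i, ∏ j, stdComplexGaussianDensity (X i j) := by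
  simp only [stdComplexGaussianDensity, gaussDensity, frobSq]
  rw [Finset.prod_congr rfl fun i _ => Finset.prod_mul_distrib, Finset.prod_mul_distrib]
  simp only [Finset.prod_const, Finset.card_univ, Fintype.card_fin, ← Real.exp_sum,
    ← Finset.sum_neg_distrib]
  rw [← pow_mul, inv_pow]

/-- `X ↦ ∑ᵢⱼ |xᵢⱼ|²` is continuous. [folklore] -/
theorem continuous_frobSq (n : ℕ) : Continuous (frobSq (n := n)) := by
  unfold frobSq; fun_prop

/-- `p_G` is continuous. [folklore] -/
theorem continuous_gaussDensity (n : ℕ) : Continuous (gaussDensity n) := by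
  unfold gaussDensity
  exact continuous_const.mul (Real.continuous_exp.comp (continuous_frobSq n).neg)

/-- `p_G` is measurable. [folklore] -/
theorem measurable_gaussDensity (n : ℕ) : Measurable (gaussDensity n) :=
  (continuous_gaussDensity n).measurable

/-- **The Gaussian ensemble has density `p_G`** (AA13 eq. (5.4)):
`𝒢^{n×n} = p_G · Lebesgue` on `ℂ^{n×n}`. [cite: AaronsonArkhipovToC2013, eq. (5.4) (p. 184)] -/
theorem gaussianMatrixMeasure_eq_withDensity (n : ℕ) :
    gaussianMatrixMeasure n = volume.withDensity (fun X => ENNReal.ofReal (gaussDensity n X)) := by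
  have hg : Measurable fun z : ℂ => ENNReal.ofReal (stdComplexGaussianDensity z) :=
    ENNReal.measurable_ofReal.comp continuous_stdComplexGaussianDensity.measurable
  -- rows
  have hrow : (Measure.pi fun _ : Fin n => stdComplexGaussian) =
      (volume : Measure (Fin n → ℂ)).withDensity
        (fun r => ∏ j, ENNReal.ofReal (stdComplexGaussianDensity (r j))) := by
    rw [stdComplexGaussian_eq_withDensity, MeasureTheory.volume_pi]
    exact Literature.MathematicalPhysics.KineticTheory.pi_withDensity_eq (fun _ => volume) (fun _ => hg)
      (fun _ => sigmaFinite_withDensity_stdComplexGaussianDensity)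
  have hrowm : Measurable fun r : Fin n → ℂ => ∏ j, ENNReal.ofReal (stdComplexGaussianDensity (r j)) :=
    Finset.measurable_prod _ fun j _ => hg.comp (measurable_pi_apply j)
  haveI : SigmaFinite ((volume : Measure (Fin n → ℂ)).withDensity
      fun r => ∏ j, ENNReal.ofReal (stdComplexGaussianDensity (r j))) := by
    rw [← hrow]; infer_instance
  rw [gaussianMatrixMeasure, hrow,
    show (volume : Measure (Fin n → Fin n → ℂ)) = Measure.pi fun _ => (volume : Measure (Fin n → ℂ))
      from MeasureTheory.volume_pi,
    Literature.MathematicalPhysics.KineticTheory.pi_withDensity_eq (fun _ => volume) (fun _ => hrowm) (fun _ => inferInstance)]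
  congr 1
  funext X
  rw [gaussDensity_eq_prod, ENNReal.ofReal_prod_of_nonneg (fun i _ => Finset.prod_nonneg
    fun j _ => (stdComplexGaussianDensity_pos _).le)]
  refine Finset.prod_congr rfl fun i _ => ?_
  rw [ENNReal.ofReal_prod_of_nonneg fun j _ => (stdComplexGaussianDensity_pos _).le]

/-! ### Gaussian tail bound (AA13 Lemma 5.3) -/

/-- The moment generating function of `x²/1` at `1/2` under `𝒩(0, 1/2)`:
`∫ e^{x²/2} d𝒩(0,1/2)(x) = √2`. [folklore] -/
theorem integral_exp_sq_half_gaussianReal :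
    ∫ x, Real.exp (x ^ 2 / 2) ∂(gaussianReal 0 (1 / 2 : ℝ≥0)) = Real.sqrt 2 := by
  have hv : (1 / 2 : ℝ≥0) ≠ 0 := by norm_num
  rw [integral_gaussianReal_eq_integral_smul hv]
  have h : ∀ x : ℝ, gaussianPDFReal 0 (1 / 2 : ℝ≥0) x • Real.exp (x ^ 2 / 2) =
      (Real.sqrt π)⁻¹ * Real.exp (-(1 / 2) * x ^ 2) := by
    intro x
    rw [gaussianPDFReal_half, smul_eq_mul, mul_assoc, ← Real.exp_add]
    congr 2; ring
  simp_rw [h]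
  rw [integral_const_mul, integral_gaussian, show π / (1 / 2) = 2 * π by ring,
    Real.sqrt_mul (by norm_num : (0 : ℝ) ≤ 2)]
  have hπ : Real.sqrt π ≠ 0 := (Real.sqrt_pos.2 Real.pi_pos).ne'
  field_simp

/-- **Chernoff bound for the standard complex Gaussian**: `Pr[|z|² ≥ a] ≤ 2 e^{−a/2}` (Markov's
inequality for `e^{|z|²/2}`, whose expectation is `(√2)² = 2`; AA13 use the exact value `e^{−a}`,
eq. (5.13) — any exponential tail suffices for Thm. 5.2). [cite: AaronsonArkhipovToC2013, Lemma 5.3 (p. 185)] -/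
theorem stdComplexGaussian_real_le_normSq_le (a : ℝ) :
    stdComplexGaussian.real {z : ℂ | a ≤ ‖z‖ ^ 2} ≤ 2 * Real.exp (-(a / 2)) := by
  set γ : Measure ℝ := gaussianReal 0 (1 / 2 : ℝ≥0) with hγ
  have hS : MeasurableSet {z : ℂ | a ≤ ‖z‖ ^ 2} :=
    measurableSet_le measurable_const (by fun_prop)
  have h1 : stdComplexGaussian.real {z : ℂ | a ≤ ‖z‖ ^ 2} =
      (γ.prod γ).real {p : ℝ × ℝ | a ≤ p.1 ^ 2 + p.2 ^ 2} := by
    rw [stdComplexGaussian, measureReal_def, MeasurableEquiv.map_apply, measureReal_def]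
    congr 1
    congr 1
    ext p
    simp only [Set.mem_preimage, Set.mem_setOf_eq, Complex.measurableEquivRealProd_symm_apply,
      Complex.sq_norm, Complex.normSq_mk]
    constructor <;> intro h <;> nlinarith [h]
  set F : ℝ × ℝ → ℝ := fun p => Real.exp (p.1 ^ 2 / 2) * Real.exp (p.2 ^ 2 / 2) with hF
  have hint1 : Integrable (fun x : ℝ => Real.exp (x ^ 2 / 2)) γ :=
    Integrable.of_integral_ne_zero (by rw [integral_exp_sq_half_gaussianReal]; positivity)
  have hFi : Integrable F (γ.prod γ) := hint1.mul_prod hint1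
  have hsub : {p : ℝ × ℝ | a ≤ p.1 ^ 2 + p.2 ^ 2} ⊆ {p | Real.exp (a / 2) ≤ F p} := by
    intro p hp
    simp only [Set.mem_setOf_eq] at hp ⊢
    rw [hF]; dsimp only
    rw [← Real.exp_add, Real.exp_le_exp]
    linarith
  have hM := mul_meas_ge_le_integral_of_nonneg (μ := γ.prod γ)
    (ae_of_all _ fun p => by rw [hF]; positivity) hFi (Real.exp (a / 2))
  have hI : ∫ p, F p ∂(γ.prod γ) = 2 := by
    rw [hF]
    rw [integral_prod_mul (μ := γ) (ν := γ) (fun x : ℝ => Real.exp (x ^ 2 / 2))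
      (fun y : ℝ => Real.exp (y ^ 2 / 2)), integral_exp_sq_half_gaussianReal,
      Real.mul_self_sqrt (by norm_num)]
  rw [hI] at hM
  have hfin : (γ.prod γ).real {p : ℝ × ℝ | Real.exp (a / 2) ≤ F p} ≤ 2 * Real.exp (-(a / 2)) := by
    rw [Real.exp_neg, ← div_eq_mul_inv, le_div_iff₀ (Real.exp_pos _), mul_comm]
    exact hM
  calc stdComplexGaussian.real {z : ℂ | a ≤ ‖z‖ ^ 2}
      = (γ.prod γ).real {p : ℝ × ℝ | a ≤ p.1 ^ 2 + p.2 ^ 2} := h1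
    _ ≤ (γ.prod γ).real {p | Real.exp (a / 2) ≤ F p} := measureReal_mono hsub
    _ ≤ 2 * Real.exp (-(a / 2)) := hfin

/-- The law of one entry of the Gaussian ensemble is the standard complex Gaussian. [folklore] -/
theorem gaussianMatrixMeasure_real_entry (n : ℕ) (i j : Fin n) {S : Set ℂ} (hS : MeasurableSet S) :
    (gaussianMatrixMeasure n).real {X | X i j ∈ S} = stdComplexGaussian.real S := by
  have h1 : MeasurePreserving (fun X : Fin n → Fin n → ℂ => X i) (gaussianMatrixMeasure n)
      (Measure.pi fun _ : Fin n => stdComplexGaussian) :=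
    measurePreserving_eval (μ := fun _ : Fin n => Measure.pi fun _ : Fin n => stdComplexGaussian) i
  have h2 : MeasurePreserving (fun r : Fin n → ℂ => r j)
      (Measure.pi fun _ : Fin n => stdComplexGaussian) stdComplexGaussian :=
    measurePreserving_eval (μ := fun _ : Fin n => stdComplexGaussian) j
  exact (h2.comp h1).measureReal_preimage hS.nullMeasurableSet

/-- **Gaussian tail** (AA13 Lemma 5.3, eqs. (5.10)–(5.13), with the Chernoff constant):
`Pr_{X ∼ 𝒢}[∑ᵢⱼ |xᵢⱼ|² > k] ≤ n² · 2e^{−k/(2n²)}` by the union bound over the `n²` entries.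
[cite: AaronsonArkhipovToC2013, Lemma 5.3 (p. 185)] -/
theorem gaussianMatrixMeasure_real_frobSq_gt_le {n : ℕ} (hn : 1 ≤ n) (k : ℝ) :
    (gaussianMatrixMeasure n).real {X | k < frobSq X} ≤
      (n : ℝ) ^ 2 * (2 * Real.exp (-(k / (n : ℝ) ^ 2 / 2))) := by
  have hn0 : (0 : ℝ) < n := by exact_mod_cast hn
  have hsub : {X : Fin n → Fin n → ℂ | k < frobSq X} ⊆
      ⋃ i : Fin n, ⋃ j : Fin n, {X | k / (n : ℝ) ^ 2 ≤ ‖X i j‖ ^ 2} := by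
    intro X hX
    by_contra hc
    simp only [Set.mem_iUnion, not_exists, Set.mem_setOf_eq, not_le] at hc
    have : frobSq X ≤ k := by
      calc frobSq X = ∑ i, ∑ j, ‖X i j‖ ^ 2 := rfl
        _ ≤ ∑ _i : Fin n, ∑ _j : Fin n, k / (n : ℝ) ^ 2 :=
            Finset.sum_le_sum fun i _ => Finset.sum_le_sum fun j _ => (hc i j).le
        _ = k := by
            simp only [Finset.sum_const, Finset.card_univ, Fintype.card_fin, nsmul_eq_mul]
            field_simp
    exact absurd hX (by simp only [Set.mem_setOf_eq, not_lt]; exact this)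
  calc (gaussianMatrixMeasure n).real {X | k < frobSq X}
      ≤ (gaussianMatrixMeasure n).real
          (⋃ i : Fin n, ⋃ j : Fin n, {X | k / (n : ℝ) ^ 2 ≤ ‖X i j‖ ^ 2}) := measureReal_mono hsub
    _ ≤ ∑ i : Fin n, (gaussianMatrixMeasure n).real
          (⋃ j : Fin n, {X | k / (n : ℝ) ^ 2 ≤ ‖X i j‖ ^ 2}) := measureReal_iUnion_fintype_le _
    _ ≤ ∑ i : Fin n, ∑ j : Fin n, (gaussianMatrixMeasure n).real
          {X | k / (n : ℝ) ^ 2 ≤ ‖X i j‖ ^ 2} :=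
        Finset.sum_le_sum fun i _ => measureReal_iUnion_fintype_le _
    _ ≤ ∑ _i : Fin n, ∑ _j : Fin n, 2 * Real.exp (-(k / (n : ℝ) ^ 2 / 2)) := by
        refine Finset.sum_le_sum fun i _ => Finset.sum_le_sum fun j _ => ?_
        have hS : MeasurableSet {z : ℂ | k / (n : ℝ) ^ 2 ≤ ‖z‖ ^ 2} :=
          measurableSet_le measurable_const (by fun_prop)
        have := gaussianMatrixMeasure_real_entry n i j hS
        simp only [Set.mem_setOf_eq] at this
        rw [this]
        exact stdComplexGaussian_real_le_normSq_le _
    _ = (n : ℝ) ^ 2 * (2 * Real.exp (-(k / (n : ℝ) ^ 2 / 2))) := by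
        simp only [Finset.sum_const, Finset.card_univ, Fintype.card_fin, nsmul_eq_mul]
        ring

/-! ### Assembly -/

section Assembly

variable {m n : ℕ} {h : n ≤ m} {c : ℝ}
  (hc : truncatedHaarMeasure m n h =
    volume.withDensity (fun X => ENNReal.ofReal (c * truncatedHaarShape m n X)))
include hc

/-- The normalising constant of eq. (5.5) is nonnegative (the total mass of `𝒮_{m,n}` is `1`, and
`shape ≥ 0`). [folklore] -/
theorem density_const_nonneg : 0 ≤ c := by
  by_contra hneg
  push Not at hneg
  have h0 : (fun X => ENNReal.ofReal (c * truncatedHaarShape m n X)) = 0 := by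
    funext X
    simp only [Pi.zero_apply, ENNReal.ofReal_eq_zero]
    exact mul_nonpos_of_nonpos_of_nonneg hneg.le (truncatedHaarShape_nonneg m n X)
  have h1 : truncatedHaarMeasure m n h Set.univ = 1 := measure_univ
  rw [hc, h0, withDensity_zero] at h1
  simp at h1

/-- **Step A** (AA13, proof of Thm. 5.2, eq. (5.63) with (5.69), integrated over `E`):
`𝒮(E) ≤ c π^{n²} e^{4n³/m} · 𝒢(E)` for `m > 2n` and measurable `E`.
[cite: AaronsonArkhipovToC2013, eqs. (5.63)–(5.69) (pp. 189–190)] -/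
theorem measureReal_le_const_mul (hnm : 2 * n < m) {E : Set (Fin n → Fin n → ℂ)}
    (hE : MeasurableSet E) :
    (truncatedHaarMeasure m n h).real E ≤
      c * (π ^ (n * n) * Real.exp (4 * (n : ℝ) ^ 3 / m)) * (gaussianMatrixMeasure n).real E := by
  have hc0 : 0 ≤ c := density_const_nonneg hc
  set B : ℝ := π ^ (n * n) * Real.exp (4 * (n : ℝ) ^ 3 / m) with hB
  have hB0 : 0 ≤ B := by positivity
  have hpt : ∀ X, ENNReal.ofReal (c * truncatedHaarShape m n X) ≤
      ENNReal.ofReal (c * B) * ENNReal.ofReal (gaussDensity n X) := by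
    intro X
    rw [← ENNReal.ofReal_mul (by positivity)]
    refine ENNReal.ofReal_le_ofReal ?_
    rw [mul_assoc]
    exact mul_le_mul_of_nonneg_left (truncatedHaarShape_le hnm X) hc0
  have hmeas : Measurable fun X => ENNReal.ofReal (gaussDensity n X) :=
    ENNReal.measurable_ofReal.comp (measurable_gaussDensity n)
  have hle : truncatedHaarMeasure m n h E ≤ ENNReal.ofReal (c * B) * gaussianMatrixMeasure n E := by
    rw [hc, withDensity_apply _ hE, gaussianMatrixMeasure_eq_withDensity, withDensity_apply _ hE,
      ← lintegral_const_mul _ hmeas]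
    exact lintegral_mono fun X => hpt X
  have hfin : ENNReal.ofReal (c * B) * gaussianMatrixMeasure n E ≠ ∞ :=
    ENNReal.mul_ne_top ENNReal.ofReal_ne_top (measure_ne_top _ _)
  calc (truncatedHaarMeasure m n h).real E
      = (truncatedHaarMeasure m n h E).toReal := rfl
    _ ≤ (ENNReal.ofReal (c * B) * gaussianMatrixMeasure n E).toReal := ENNReal.toReal_mono hfin hle
    _ = c * B * (gaussianMatrixMeasure n).real E := by
        rw [ENNReal.toReal_mul, ENNReal.toReal_ofReal (by positivity)]; rfl

/-- **Step B** (the lower half of AA13 Lemma 5.6, eqs. (5.56)–(5.59): `ζ s_head ≥ g_head − Δ̃_head`):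
integrating the head lower bound against `∫ p_S = 1` gives `c (1 − 2nk²/m) π^{n²} 𝒢(H) ≤ 1` for the
head `H = {∑ᵢⱼ |xᵢⱼ|² ≤ k}`, `2k ≤ m`, `2n ≤ m`. [cite: AaronsonArkhipovToC2013, Lemma 5.6 (p. 189)] -/
theorem const_mul_head_le_one (hnm : 2 * n ≤ m) (hm : 0 < m) {k : ℝ} (hkm : 2 * k ≤ m)
    (hη : 2 * n * k ^ 2 / m ≤ 1) :
    c * ((1 - 2 * n * k ^ 2 / m) * π ^ (n * n)) *
        (gaussianMatrixMeasure n).real {X | frobSq X ≤ k} ≤ 1 := by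
  have hc0 : 0 ≤ c := density_const_nonneg hc
  set A : ℝ := (1 - 2 * n * k ^ 2 / m) * π ^ (n * n) with hA
  have hA0 : 0 ≤ A := by rw [hA]; exact mul_nonneg (by linarith) (by positivity)
  have hH : MeasurableSet {X : Fin n → Fin n → ℂ | frobSq X ≤ k} :=
    measurableSet_le (continuous_frobSq n).measurable measurable_const
  have hpt : ∀ X ∈ {X : Fin n → Fin n → ℂ | frobSq X ≤ k},
      ENNReal.ofReal (c * A) * ENNReal.ofReal (gaussDensity n X) ≤
        ENNReal.ofReal (c * truncatedHaarShape m n X) := by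
    intro X hX
    rw [← ENNReal.ofReal_mul (by positivity)]
    refine ENNReal.ofReal_le_ofReal ?_
    rw [mul_assoc]
    refine mul_le_mul_of_nonneg_left ?_ hc0
    have := le_truncatedHaarShape hnm hm hkm X hX
    rw [hA]; linarith
  have hmeas : Measurable fun X => ENNReal.ofReal (gaussDensity n X) :=
    ENNReal.measurable_ofReal.comp (measurable_gaussDensity n)
  have h1 : ∫⁻ X, ENNReal.ofReal (c * truncatedHaarShape m n X) ∂volume = 1 := by
    have := (measure_univ : truncatedHaarMeasure m n h Set.univ = 1)
    rwa [hc, withDensity_apply _ MeasurableSet.univ, Measure.restrict_univ] at this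
  have hle : ENNReal.ofReal (c * A) * gaussianMatrixMeasure n {X | frobSq X ≤ k} ≤ 1 := by
    calc ENNReal.ofReal (c * A) * gaussianMatrixMeasure n {X | frobSq X ≤ k}
        = ∫⁻ X in {X | frobSq X ≤ k}, ENNReal.ofReal (c * A) * ENNReal.ofReal (gaussDensity n X)
            ∂volume := by
          rw [gaussianMatrixMeasure_eq_withDensity, withDensity_apply _ hH, lintegral_const_mul _ hmeas]
      _ ≤ ∫⁻ X in {X | frobSq X ≤ k}, ENNReal.ofReal (c * truncatedHaarShape m n X) ∂volume :=
          setLIntegral_mono' hH hpt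
      _ ≤ ∫⁻ X, ENNReal.ofReal (c * truncatedHaarShape m n X) ∂volume := setLIntegral_le_lintegral _ _
      _ = 1 := h1
  have hfin : ENNReal.ofReal (c * A) * gaussianMatrixMeasure n {X | frobSq X ≤ k} ≠ ∞ :=
    ENNReal.mul_ne_top ENNReal.ofReal_ne_top (measure_ne_top _ _)
  have := ENNReal.toReal_mono ENNReal.one_ne_top hle
  rwa [ENNReal.toReal_mul, ENNReal.toReal_ofReal (by positivity), ENNReal.toReal_one] at this

end Assembly

/-! ### Numerical constants -/

/-- `1 ≤ log 200`. [folklore] -/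
theorem one_le_log_two_hundred : (1 : ℝ) ≤ Real.log 200 := by
  rw [Real.le_log_iff_exp_le (by norm_num)]
  have := Real.exp_one_lt_d9
  linarith

/-- **The Haar-Unitary Hiding Theorem (AA13 Thm. 5.2) from the density formula (5.5), which is
only needed for `m > 2n`.** With `C = 150` and `δ₀ = 1/200`: for `n ≥ 1`, `0 < δ ≤ δ₀` and
`m ≥ (n⁵/δ) ln²(n/δ)` (which forces `m ≥ 200 n > 2n`), `𝒮_{m,n}(E) ≤ (1 + Cδ) 𝒢^{n×n}(E)` for every
measurable `E` — Steps A and B with the head radius `k = 6n² ln(n/δ)` (AA13 p. 189: "set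
`k := 6n² log(n/δ)`"), the Gaussian tail bound, and `e^{4n³/m} ≤ 1 + 5δ`. The hypothesis is Réffy's
density in measure form for `2n < m` only (the form proved in `HaarUnitaryHidingDischarge`);
`haarUnitaryHiding_of_truncatedHaarDensity` is the special case fed by the named fact.
[cite: AaronsonArkhipovToC2013, Thm. 5.2 (p. 183), proof pp. 189–190] -/
theorem haarUnitaryHiding_of_truncatedHaarDensityLt
    (hD : ∀ (m n : ℕ) (h : n ≤ m), 2 * n < m →
      ∃ c : ℝ, truncatedHaarMeasure m n h =
        volume.withDensity (fun X => ENNReal.ofReal (c * truncatedHaarShape m n X))) :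
    haarUnitaryHiding := by
  refine ⟨150, 1 / 200, by norm_num, ?_⟩
  intro n m h δ hn hδ hδ₀ hm E hE
  -- basic positivity
  have hn0 : (0 : ℝ) < n := by exact_mod_cast hn
  have hn1 : (1 : ℝ) ≤ n := by exact_mod_cast hn
  have hL1 : 1 ≤ Real.log (n / δ) := by
    have h200 : (200 : ℝ) ≤ n / δ := by
      rw [le_div_iff₀ hδ]
      calc 200 * δ ≤ 200 * (1 / 200) := mul_le_mul_of_nonneg_left hδ₀ (by norm_num)
        _ = 1 := by norm_num
        _ ≤ n := hn1
    calc (1 : ℝ) ≤ Real.log 200 := one_le_log_two_hundred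
      _ ≤ Real.log (n / δ) := Real.log_le_log (by norm_num) h200
  obtain ⟨L, hL⟩ : ∃ L : ℝ, L = Real.log (n / δ) := ⟨_, rfl⟩
  rw [← hL] at hm hL1
  have hL0 : 0 < L := by linarith
  -- m is large
  have hmδ : (n : ℝ) ^ 5 * L ^ 2 ≤ δ * m := by
    have : (n : ℝ) ^ 5 / δ * L ^ 2 = (n : ℝ) ^ 5 * L ^ 2 / δ := by ring
    rw [this, div_le_iff₀ hδ] at hm
    linarith
  have hn5 : (0 : ℝ) < (n : ℝ) ^ 5 := by positivity
  have hm5 : (n : ℝ) ^ 5 ≤ δ * m := by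
    have hL2 : (1 : ℝ) ≤ L ^ 2 := one_le_pow₀ hL1
    have : (n : ℝ) ^ 5 * 1 ≤ (n : ℝ) ^ 5 * L ^ 2 := mul_le_mul_of_nonneg_left hL2 hn5.le
    linarith
  have hmnn : (0 : ℝ) ≤ m := Nat.cast_nonneg m
  have hm200 : 200 * (n : ℝ) ≤ m := by
    have h1 : (n : ℝ) ≤ (n : ℝ) ^ 5 := by
      calc (n : ℝ) = (n : ℝ) ^ 1 := (pow_one _).symm
        _ ≤ (n : ℝ) ^ 5 := pow_le_pow_right₀ hn1 (by norm_num)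
    have h2 : δ * m ≤ 1 / 200 * m := mul_le_mul_of_nonneg_right hδ₀ hmnn
    linarith
  have hmpos : (0 : ℝ) < m := by linarith
  have hm0 : 0 < m := by exact_mod_cast hmpos
  have hnm : 2 * n < m := by
    have : (2 * n : ℝ) < m := by linarith
    exact_mod_cast this
  -- the head radius k = 6 n² L
  obtain ⟨k, hk⟩ : ∃ k : ℝ, k = 6 * (n : ℝ) ^ 2 * L := ⟨_, rfl⟩
  have hk0 : 0 < k := by rw [hk]; positivity
  have hkm : 2 * k ≤ m := by
    -- 12 n² L δ ≤ n⁵ L² ≤ δ m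
    have h1 : 12 * δ ≤ (n : ℝ) ^ 3 * L := by
      have h3 : (1 : ℝ) ≤ (n : ℝ) ^ 3 := one_le_pow₀ hn1
      calc 12 * δ ≤ 12 * (1 / 200) := mul_le_mul_of_nonneg_left hδ₀ (by norm_num)
        _ ≤ 1 * 1 := by norm_num
        _ ≤ (n : ℝ) ^ 3 * L := mul_le_mul h3 hL1 (by norm_num) (by positivity)
    have h2 : 2 * k * δ ≤ (n : ℝ) ^ 5 * L ^ 2 := by
      have e1 : 2 * k * δ = (n : ℝ) ^ 2 * L * (12 * δ) := by rw [hk]; ring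
      have e2 : (n : ℝ) ^ 5 * L ^ 2 = (n : ℝ) ^ 2 * L * ((n : ℝ) ^ 3 * L) := by ring
      rw [e1, e2]
      exact mul_le_mul_of_nonneg_left h1 (by positivity)
    have h3 : 2 * k * δ ≤ m * δ := by linarith
    exact le_of_mul_le_mul_right h3 hδ
  -- η = 2 n k²/m ≤ 72 δ
  have hη : 2 * n * k ^ 2 / m ≤ 72 * δ := by
    rw [div_le_iff₀ hmpos]
    have e1 : 2 * (n : ℝ) * k ^ 2 = 72 * ((n : ℝ) ^ 5 * L ^ 2) := by rw [hk]; ring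
    rw [e1]
    have := mul_le_mul_of_nonneg_left hmδ (by norm_num : (0 : ℝ) ≤ 72)
    linarith
  have hη1 : 2 * n * k ^ 2 / m ≤ 1 := by linarith
  -- the tail τ ≤ 2 δ³ ≤ δ
  have hτ : (n : ℝ) ^ 2 * (2 * Real.exp (-(k / (n : ℝ) ^ 2 / 2))) ≤ δ := by
    have hexp : Real.exp (-(k / (n : ℝ) ^ 2 / 2)) = (δ / n) ^ 3 := by
      have e1 : -(k / (n : ℝ) ^ 2 / 2) = (3 : ℕ) * Real.log (δ / n) := by
        rw [hk, Real.log_div hδ.ne' hn0.ne', hL, Real.log_div hn0.ne' hδ.ne']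
        field_simp
        ring
      rw [e1, Real.exp_nat_mul, Real.exp_log (by positivity)]
    rw [hexp]
    have e2 : (n : ℝ) ^ 2 * (2 * (δ / n) ^ 3) = 2 * δ ^ 3 / n := by
      field_simp
    rw [e2, div_le_iff₀ hn0]
    have hδ2 : δ ^ 2 ≤ 1 / 4 := by
      calc δ ^ 2 ≤ (1 / 200) ^ 2 := pow_le_pow_left₀ hδ.le hδ₀ 2
        _ ≤ 1 / 4 := by norm_num
    calc 2 * δ ^ 3 = (2 * δ ^ 2) * δ := by ring
      _ ≤ 1 * δ := mul_le_mul_of_nonneg_right (by linarith) hδ.le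
      _ ≤ δ * n := by rw [one_mul]; exact le_mul_of_one_le_right hδ.le hn1
  -- Step A and Step B
  obtain ⟨c, hc⟩ := hD m n h hnm
  have hA := measureReal_le_const_mul hc hnm hE
  have hB := const_mul_head_le_one hc hnm.le hm0 hkm hη1
  -- 𝒢(head) ≥ 1 - δ
  have hH : MeasurableSet {X : Fin n → Fin n → ℂ | frobSq X ≤ k} :=
    measurableSet_le (continuous_frobSq n).measurable measurable_const
  have hhead : 1 - δ ≤ (gaussianMatrixMeasure n).real {X | frobSq X ≤ k} := by
    have hcpl : (gaussianMatrixMeasure n).real {X | frobSq X ≤ k}ᶜ ≤ δ := by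
      have e1 : {X : Fin n → Fin n → ℂ | frobSq X ≤ k}ᶜ = {X | k < frobSq X} := by
        ext X; simp
      rw [e1]
      exact (gaussianMatrixMeasure_real_frobSq_gt_le hn k).trans hτ
    have := probReal_compl_eq_one_sub (μ := gaussianMatrixMeasure n) hH
    linarith
  -- e^{4n³/m} ≤ 1 + 5δ
  have hE4 : Real.exp (4 * (n : ℝ) ^ 3 / m) ≤ 1 + 5 * δ := by
    have hx : 4 * (n : ℝ) ^ 3 / m ≤ 4 * δ := by
      rw [div_le_iff₀ hmpos]
      have h35 : (n : ℝ) ^ 3 ≤ (n : ℝ) ^ 5 := pow_le_pow_right₀ hn1 (by norm_num)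
      linarith
    have hx0 : 0 ≤ 4 * (n : ℝ) ^ 3 / m := by positivity
    have hx1 : |4 * (n : ℝ) ^ 3 / m| ≤ 1 := by
      rw [abs_of_nonneg hx0]; linarith
    have h1 := (abs_le.1 (Real.abs_exp_sub_one_sub_id_le hx1)).2
    have h2 : (4 * (n : ℝ) ^ 3 / m) ^ 2 ≤ δ := by
      calc (4 * (n : ℝ) ^ 3 / m) ^ 2 ≤ (4 * δ) ^ 2 := pow_le_pow_left₀ hx0 hx 2
        _ = (16 * δ) * δ := by ring
        _ ≤ 1 * δ := mul_le_mul_of_nonneg_right (by linarith) hδ.le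
        _ = δ := one_mul δ
    linarith
  -- put everything together
  have hG0 : 0 ≤ (gaussianMatrixMeasure n).real E := measureReal_nonneg
  have hc0 : 0 ≤ c := density_const_nonneg hc
  have hκ0 : 0 ≤ c * π ^ (n * n) := by positivity
  have hA' : (truncatedHaarMeasure m n h).real E ≤
      c * π ^ (n * n) * (1 + 5 * δ) * (gaussianMatrixMeasure n).real E := by
    calc (truncatedHaarMeasure m n h).real E
        ≤ c * (π ^ (n * n) * Real.exp (4 * (n : ℝ) ^ 3 / m)) *
            (gaussianMatrixMeasure n).real E := hA
      _ = c * π ^ (n * n) * Real.exp (4 * (n : ℝ) ^ 3 / m) *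
            (gaussianMatrixMeasure n).real E := by ring
      _ ≤ c * π ^ (n * n) * (1 + 5 * δ) * (gaussianMatrixMeasure n).real E :=
          mul_le_mul_of_nonneg_right (mul_le_mul_of_nonneg_left hE4 hκ0) hG0
  have hB' : c * π ^ (n * n) * ((1 - 72 * δ) * (1 - δ)) ≤ 1 := by
    calc c * π ^ (n * n) * ((1 - 72 * δ) * (1 - δ))
        ≤ c * π ^ (n * n) *
            ((1 - 2 * n * k ^ 2 / m) * (gaussianMatrixMeasure n).real {X | frobSq X ≤ k}) := by
          refine mul_le_mul_of_nonneg_left ?_ hκ0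
          exact mul_le_mul (by linarith) hhead (by linarith) (by linarith)
      _ = c * ((1 - 2 * n * k ^ 2 / m) * π ^ (n * n)) *
            (gaussianMatrixMeasure n).real {X | frobSq X ≤ k} := by ring
      _ ≤ 1 := hB
  have hD1 : (0 : ℝ) < 1 - 72 * δ := by linarith
  have hD2 : (0 : ℝ) < 1 - δ := by linarith
  have hD0 : (0 : ℝ) < (1 - 72 * δ) * (1 - δ) := mul_pos hD1 hD2
  have hκle : c * π ^ (n * n) ≤ 1 / ((1 - 72 * δ) * (1 - δ)) := by
    rw [le_div_iff₀ hD0]; exact hB'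
  have hpoly : 1 + 5 * δ ≤ (1 + 150 * δ) * ((1 - 72 * δ) * (1 - δ)) := by
    have e1 : (1 + 150 * δ) * ((1 - 72 * δ) * (1 - δ)) =
        1 + 77 * δ - 10878 * δ ^ 2 + 10800 * δ ^ 3 := by ring
    rw [e1]
    have h1 : 10878 * δ ^ 2 ≤ 72 * δ := by
      calc 10878 * δ ^ 2 = (10878 * δ) * δ := by ring
        _ ≤ 72 * δ := by
            refine mul_le_mul_of_nonneg_right ?_ hδ.le
            linarith
    have h2 : 0 ≤ 10800 * δ ^ 3 := by positivity
    linarith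
  have hfinal : c * π ^ (n * n) * (1 + 5 * δ) ≤ 1 + 150 * δ := by
    calc c * π ^ (n * n) * (1 + 5 * δ)
        ≤ 1 / ((1 - 72 * δ) * (1 - δ)) * (1 + 5 * δ) :=
          mul_le_mul_of_nonneg_right hκle (by linarith)
      _ ≤ 1 + 150 * δ := by
          rw [div_mul_eq_mul_div, one_mul, div_le_iff₀ hD0]
          exact hpoly
  calc (truncatedHaarMeasure m n h).real E
      ≤ c * π ^ (n * n) * (1 + 5 * δ) * (gaussianMatrixMeasure n).real E := hA'
    _ ≤ (1 + 150 * δ) * (gaussianMatrixMeasure n).real E :=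
        mul_le_mul_of_nonneg_right hfinal hG0

/-- **The Haar-Unitary Hiding Theorem (AA13 Thm. 5.2) from the density formula (5.5)** (the named
fact `truncatedHaarDensity`, used only at `2n < m`: `haarUnitaryHiding_of_truncatedHaarDensityLt`).
[cite: AaronsonArkhipovToC2013, Thm. 5.2 (p. 183), proof pp. 189–190] -/
theorem haarUnitaryHiding_of_truncatedHaarDensity (hD : truncatedHaarDensity) :
    haarUnitaryHiding :=
  haarUnitaryHiding_of_truncatedHaarDensityLt fun m n h hlt => hD m n h hlt.le

/-- **AA13 Thm. 5.1 from Réffy's density formula**: `‖𝒮_{m,n} − 𝒢^{n×n}‖ = O(δ)` for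
`m ≥ (n⁵/δ) log²(n/δ)` (via Thm. 5.2 and `haarUnitaryTruncation_tv_of_hiding`).
[cite: AaronsonArkhipovToC2013, Thm. 5.1 (p. 183)] -/
theorem haarUnitaryTruncation_tv_of_truncatedHaarDensity (hD : truncatedHaarDensity) :
    haarUnitaryTruncation_tv :=
  haarUnitaryTruncation_tv_of_hiding (haarUnitaryHiding_of_truncatedHaarDensity hD)

end Literature.Computability.QuantumComplexity
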